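import Summits.AtomisticToContinuum.BoseEinsteinCondensation.Theses.BECInsertionCorrector
import Summits.AtomisticToContinuum.BoseEinsteinCondensation.Theorems.CorrectorClosure.Negative.InsertionResidueLoadBearing
import Summits.AtomisticToContinuum.BoseEinsteinCondensation.Theorems.BECInsertionCorrectorCorrectorClosureResponseDictionaryLimit
import Summits.AtomisticToContinuum.BoseEinsteinCondensation.Theorems.BECInsertionCorrectorCorrectorClosureResponseDictionarySymm
import HarnessLib

/-!
# Crux `CorrectorClosure` (stmt-AtomisticToContinuum-12058), line `healing-scale-kac-insertion` —
# registered stub `stub_responseDictionary`: the static response bound in `H₋₁` currency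

Supports (does not close) stmt-AtomisticToContinuum-12058, route `BECInsertionCorrector`. This is
where the line CONSUMES K1 (`StaticResponseBound`, by name): for a bounded repulsive finite-range `v`,
in the box `L = ((N+1)/ρ)^{1/3}` holding the `N`-body bath at density `ρ' = ρN/(N+1)` (so that K1
applies verbatim to the bath, `sideLength ρ' N = L`), if the bath has a continuous torus Feynman–Kac
ground state `Θ₀` then every density mode `g_k = ∑ⱼ cos(p·xⱼ)`, `p = 2πk/L ≠ 0`, has Kipnis–Varadhan
norm `‖g_k‖²_{H₋₁(G_Θ)} = hMinusOneSqW L Θ₀ g_k ≤ C N / max(ρ'a, |p|²)` — the route's support item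
`StaticResponseToHMinusOne` transported from (non-existent) `C¹` attainers to FK ground states.

Proof (form-domain-free): K1 at the normalised real trial states `f/‖f‖` reads
`(E₀ - C_K t²)∫f² ≤ ∫|∇f|² + ∫f²V^per + t∫f²g` (`varResponse_of_staticResponse`); feed it with
`f = (1 + sβ)Θ_n`, `Θ_n = ρ_{1/(n+1)} ⋆ Θ₀` the mollified ground state (kinetic integrals `≤ E₀ - ∫Θ₀²V`,
part B), expand to second order in `s` (part A), pass to the limit with the discriminant trick
(part C), read off `2∫gβΘ₀² - ∫|∇β|²Θ₀² ≤ C_K` for symmetric tests and symmetrise (part S).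
-/

noncomputable section

open MeasureTheory Filter
open scoped ENNReal NNReal BigOperators Topology

namespace Summit.AtomisticToContinuum.BoseEinsteinCondensation.Theorems.CorrectorClosure.HealingScaleKacInsertion.ResponseDictionary

open Literature.MathematicalPhysics.QuantumManyBody.BoseGas

variable {N : ℕ}

/-! ### The endgame in `ℝ` -/

/-- **The endgame in `ℝ`.** If for all `|s| ≤ s₀` and all real `t`
`-C t²(1 + 2sB₁ + s²B₂) ≤ s²D + t(G₀ + 2sG₁ + s²G₂)`, then `2G₁ - D ≤ C`
(`s = 0` forces `G₀ = 0`; then `s = -t`, divide by `t²`, `t → 0⁺`). [folklore] -/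
theorem response_endgame {CK B₁ B₂ D G₀ G₁ G₂ s₀ : ℝ} (hs₀ : 0 < s₀)
    (h : ∀ s : ℝ, |s| ≤ s₀ → ∀ t : ℝ,
      -(CK * t ^ 2) * (1 + 2 * s * B₁ + s ^ 2 * B₂) ≤
        s ^ 2 * D + t * (G₀ + 2 * s * G₁ + s ^ 2 * G₂)) :
    2 * G₁ - D ≤ CK := by
  -- first order: `G₀ = 0`
  have hG₀ : G₀ = 0 := by
    by_contra hne
    set u : ℝ := 1 / (|CK| + 1) with hu
    have hu0 : 0 < u := by positivity
    have huC : CK * u < 1 := by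
      rw [hu, mul_one_div, div_lt_one (by positivity)]; linarith [le_abs_self CK]
    have h0 := h 0 (by rw [abs_zero]; exact hs₀.le) (-(G₀ * u))
    have hG2 : 0 < G₀ ^ 2 := by positivity
    have hpos : 0 < G₀ ^ 2 * u * (1 - CK * u) := mul_pos (mul_pos hG2 hu0) (by linarith)
    nlinarith
  -- second order along `s = -t`
  set K : ℝ := |G₂| + 2 * (|CK| * |B₁|) + |CK| * s₀ * |B₂| with hK
  have hK0 : 0 ≤ K := by positivity
  have hKt : ∀ t : ℝ, 0 < t → t ≤ s₀ → 2 * G₁ - D - CK ≤ t * K := by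
    intro t ht hts
    have h1 := h (-t) (by rw [abs_neg, abs_of_pos ht]; exact hts) t
    rw [hG₀] at h1
    have h2 : t ^ 2 * (2 * G₁ - D - CK) ≤ t ^ 2 * (t * (G₂ - 2 * CK * B₁ + CK * t * B₂)) := by
      nlinarith
    have h3 : 2 * G₁ - D - CK ≤ t * (G₂ - 2 * CK * B₁ + CK * t * B₂) :=
      le_of_mul_le_mul_left h2 (by positivity)
    have e1 : -(2 * CK * B₁) ≤ 2 * (|CK| * |B₁|) := by
      rw [← abs_mul]; linarith [neg_abs_le (CK * B₁)]
    have e2 : CK * t * B₂ ≤ |CK| * s₀ * |B₂| :=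
      calc CK * t * B₂ ≤ |CK * t * B₂| := le_abs_self _
        _ = |CK| * t * |B₂| := by rw [abs_mul, abs_mul, abs_of_pos ht]
        _ ≤ |CK| * s₀ * |B₂| := by gcongr
    have e3 : G₂ ≤ |G₂| := le_abs_self _
    have h4 : t * (G₂ - 2 * CK * B₁ + CK * t * B₂) ≤ t * K :=
      mul_le_mul_of_nonneg_left (by rw [hK]; linarith) ht.le
    linarith
  -- `t → 0⁺`
  by_contra hlt
  have hx : 0 < 2 * G₁ - D - CK := by linarith
  set t : ℝ := min s₀ ((2 * G₁ - D - CK) / (2 * (K + 1))) with ht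
  have ht0 : 0 < t := lt_min hs₀ (by positivity)
  have h1 := hKt t ht0 (min_le_left _ _)
  have h2 : t * K ≤ (2 * G₁ - D - CK) / (2 * (K + 1)) * K :=
    mul_le_mul_of_nonneg_right (min_le_right _ _) hK0
  have h3 : (2 * G₁ - D - CK) / (2 * (K + 1)) * K < 2 * G₁ - D - CK := by
    rw [div_mul_eq_mul_div, div_lt_iff₀ (by positivity)]; nlinarith
  linarith

/-! ### K1 at normalised real trial states: the variational response inequality in real form -/

/-- **The energy-currency response bound at the real trial states `f/‖f‖`.** If in the box `L` the
bound `E₀ - C_K t² ≤ E(Ψ) + t⟨g⟩_Ψ` holds for all finite-energy periodic trial states `Ψ` (bounded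
`v^per`), then for every symmetric periodic real `C¹` `f` with `∫_cell f² > 0` and every real `t`,
`(E₀ - C_K t²)∫f² ≤ ∫|∇f|² + ∫f²V^per + t∫f²g` (real Bochner integrals on the cell). [folklore] -/
theorem varResponse_of_staticResponse {v : ℝ → ℝ≥0∞} (hv : Measurable v) {L : ℝ} {C : ℝ≥0}
    (hC : ∀ x, periodizedPotential v L x ≤ C) {g : Config N → ℝ} {CK : ℝ}
    (hK : ∀ (t : ℝ) (Ψ : PeriodicTrialState N L), periodicEnergy v Ψ ≠ ⊤ →
      (periodicGroundStateEnergy v N L).toReal - CK * t ^ 2 ≤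
        (periodicEnergy v Ψ).toReal + t * ∫ X in cellN N L, g X * ‖Ψ.ψ X‖ ^ 2)
    (f : Config N → ℝ) (hf : ContDiff ℝ 1 f)
    (hper : ∀ (X : Config N) (i : Fin N) (k : Fin 3),
      f (X + Pi.single i (EuclideanSpace.single k L)) = f X)
    (hsymm : ∀ (σ : Equiv.Perm (Fin N)) (X : Config N), f (X ∘ σ) = f X)
    (hpos : 0 < ∫ X in cellN N L, f X ^ 2) (t : ℝ) :
    ((periodicGroundStateEnergy v N L).toReal - CK * t ^ 2) * ∫ X in cellN N L, f X ^ 2 ≤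
      (∫ X in cellN N L, gradDot f f X) +
        (∫ X in cellN N L, f X ^ 2 * (periodicInteraction v L X).toReal) +
        t * ∫ X in cellN N L, f X ^ 2 * g X := by
  -- adapted from the proof of `periodicGroundStateEnergy_le_ofReal_of_eigen` (PeriodicFeynmanKacTrialState)
  set m : ℝ := ∫ X in cellN N L, f X ^ 2 with hm
  have hfsq : Integrable (fun X => f X ^ 2) (volume.restrict (cellN N L)) :=
    integrableOn_cellN (hf.continuous.pow 2) L
  set c : ℝ := (Real.sqrt m)⁻¹ with hc
  have hc2 : c ^ 2 = m⁻¹ := by rw [hc, inv_pow, Real.sq_sqrt hpos.le]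
  have hnormΨ : ∫⁻ X in cellN N L, ((‖((c * f X : ℝ) : ℂ)‖₊ : ℝ≥0∞)) ^ 2 = 1 := by
    have h1 : ∀ X, ((‖((c * f X : ℝ) : ℂ)‖₊ : ℝ≥0∞)) ^ 2 =
        ENNReal.ofReal (c ^ 2) * ENNReal.ofReal (f X ^ 2) := fun X => by
      rw [ennnorm_sq_ofReal_periodic, mul_pow, ENNReal.ofReal_mul (sq_nonneg _)]
    simp_rw [h1]
    rw [lintegral_const_mul' _ _ ENNReal.ofReal_ne_top,
      ← ofReal_integral_eq_lintegral_ofReal hfsq (Eventually.of_forall fun X => sq_nonneg _),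
      ← ENNReal.ofReal_mul (sq_nonneg _), hc2, ← hm, inv_mul_cancel₀ hpos.ne', ENNReal.ofReal_one]
  let Ψ : PeriodicTrialState N L :=
    { ψ := fun X => (((c * f X : ℝ)) : ℂ)
      contDiff := Complex.ofRealCLM.contDiff.comp (contDiff_const.mul hf)
      periodic := fun X i k => by
        show (((c * f (X + Pi.single i (EuclideanSpace.single k L)) : ℝ)) : ℂ) = (((c * f X : ℝ)) : ℂ)
        rw [hper]
      symm := fun σ X => by
        show (((c * f (X ∘ σ) : ℝ)) : ℂ) = (((c * f X : ℝ)) : ℂ)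
        rw [hsymm]
      norm_eq := hnormΨ }
  set K : ℝ := ∫ X in cellN N L, gradDot f f X with hKdef
  set P : ℝ := ∫ X in cellN N L, f X ^ 2 * (periodicInteraction v L X).toReal with hPdef
  have hK0 : 0 ≤ K := integral_nonneg fun X => gradDot_self_nonneg f X
  have hP0 : 0 ≤ P := integral_nonneg fun X => mul_nonneg (sq_nonneg _) ENNReal.toReal_nonneg
  have hE : periodicEnergy v Ψ = ENNReal.ofReal (c ^ 2 * (K + P)) := by
    rw [periodicEnergy_of_ofReal_mul Ψ hf rfl v, setLIntegral_realKinetic_eq_ofReal L hf,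
      setLIntegral_cellN_sq_mul_periodicInteraction_eq_ofReal hv hC hf.continuous.measurable hfsq,
      ← ENNReal.ofReal_add hK0 hP0, ← ENNReal.ofReal_mul (sq_nonneg _)]
  have hEtop : periodicEnergy v Ψ ≠ ⊤ := by rw [hE]; exact ENNReal.ofReal_ne_top
  have hEreal : (periodicEnergy v Ψ).toReal = c ^ 2 * (K + P) := by
    rw [hE, ENNReal.toReal_ofReal (by positivity)]
  have hpair : ∫ X in cellN N L, g X * ‖Ψ.ψ X‖ ^ 2 = c ^ 2 * ∫ X in cellN N L, f X ^ 2 * g X := by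
    rw [← integral_const_mul]
    refine integral_congr_ae (ae_of_all _ fun X => ?_)
    show g X * ‖(((c * f X : ℝ)) : ℂ)‖ ^ 2 = c ^ 2 * (f X ^ 2 * g X)
    rw [Complex.norm_real, Real.norm_eq_abs, sq_abs]
    ring
  have key := hK t Ψ hEtop
  rw [hEreal, hpair, hc2] at key
  have h2 := mul_le_mul_of_nonneg_right key hpos.le
  have h3 : (m⁻¹ * (K + P) + t * (m⁻¹ * ∫ X in cellN N L, f X ^ 2 * g X)) * m =
      K + P + t * ∫ X in cellN N L, f X ^ 2 * g X := by
    field_simp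
  rw [h3] at h2
  linarith

/-! ### The core: an energy-currency response bound gives the `H₋₁` bound for the FK ground state -/

/-- **Static response in `H₋₁` currency for a torus Feynman–Kac ground state.** Let `L > 0`, `v`
measurable with bounded periodisation, `Θ₀` a continuous torus FK ground state of `N` bodies in the
box `L`, `g` a bounded continuous permutation-symmetric observable, `C_K` real, and suppose the
energy-currency response bound `E₀ - C_K t² ≤ E(Ψ) + t ∫_cell g|Ψ|²` holds for all real `t` and all
finite-energy periodic trial states `Ψ`. Then `hMinusOneSqW L Θ₀ g ≤ C_K` (for `C_K < 0` the
hypothesis is contradictory and the conclusion reads `‖g‖₋₁ = 0`). [folklore] -/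
theorem hMinusOneSqW_le_of_fk_staticResponse {v : ℝ → ℝ≥0∞} (hv : Measurable v) {L : ℝ} (hL : 0 < L)
    {C : ℝ≥0} (hC : ∀ x, periodizedPotential v L x ≤ C) {Θ₀ : Config N → ℝ}
    (hΘ : IsPeriodicGroundStateFK v L Θ₀) (hΘc : Continuous Θ₀)
    {g : Config N → ℝ} (hg : Continuous g) {Bg : ℝ} (hBg : ∀ X, |g X| ≤ Bg)
    (hgsymm : ∀ (σ : Equiv.Perm (Fin N)) (X : Config N), g (X ∘ σ) = g X) {CK : ℝ}
    (hK : ∀ (t : ℝ) (Ψ : PeriodicTrialState N L), periodicEnergy v Ψ ≠ ⊤ →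
      (periodicGroundStateEnergy v N L).toReal - CK * t ^ 2 ≤
        (periodicEnergy v Ψ).toReal + t * ∫ X in cellN N L, g X * ‖Ψ.ψ X‖ ^ 2) :
    hMinusOneSqW L Θ₀ g ≤ ENNReal.ofReal CK := by
  have hE₀ : 0 ≤ (periodicGroundStateEnergy v N L).toReal := ENNReal.toReal_nonneg
  obtain ⟨M, -, hM⟩ := exists_bound_of_continuous_periodic hL hΘc hΘ.periodic
  obtain ⟨hVm, hVb⟩ := interaction_toReal_measurable_bdd (N := N) hv L hC
  have hnorm := integral_sq_eq_one_of_fk hΘ hΘc hL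
  -- the mollified ground states `Θ_n = ρ_{1/(n+1)} ⋆ Θ₀`
  have hFC : ∀ n : ℕ, ContDiff ℝ 1 (mollify (Nat.one_div_pos_of_nat (n := n)) Θ₀) := fun n =>
    contDiff_mollify _ hΘc.locallyIntegrable
  have hFper : ∀ (n : ℕ) (X : Config N) (i : Fin N) (k : Fin 3),
      mollify (Nat.one_div_pos_of_nat (n := n)) Θ₀ (X + Pi.single i (EuclideanSpace.single k L)) =
        mollify (Nat.one_div_pos_of_nat (n := n)) Θ₀ X := fun n X i k => mollify_periodic Nat.one_div_pos_of_nat hΘ.periodic X i k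
  have hFsymm : ∀ (n : ℕ) (σ : Equiv.Perm (Fin N)) (X : Config N),
      mollify (Nat.one_div_pos_of_nat (n := n)) Θ₀ (X ∘ σ) = mollify (Nat.one_div_pos_of_nat (n := n)) Θ₀ X := fun n σ X =>
    mollify_comp_perm Nat.one_div_pos_of_nat hΘ.symm σ X
  have hFM : ∀ (n : ℕ) (X : Config N), |mollify (Nat.one_div_pos_of_nat (n := n)) Θ₀ X| ≤ M := fun n X =>
    abs_mollify_le _ hM X
  have hunif : ∀ s : ℝ, 0 < s → ∀ᶠ n : ℕ in atTop, ∀ X, |mollify (Nat.one_div_pos_of_nat (n := n)) Θ₀ X - Θ₀ X| ≤ s :=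
    fun s hs => eventually_abs_mollify_sub_le hL hΘc hΘ.periodic hs
  have hkin : ∀ n : ℕ, ∫ X in cellN N L, gradDot (mollify (Nat.one_div_pos_of_nat (n := n)) Θ₀) (mollify (Nat.one_div_pos_of_nat (n := n)) Θ₀) X ≤
      (periodicGroundStateEnergy v N L).toReal -
        ∫ X in cellN N L, Θ₀ X ^ 2 * (periodicInteraction v L X).toReal := fun n =>
    integral_gradDot_mollify_le hΘ hv hΘc hL hC Nat.one_div_pos_of_nat
  -- symmetric tests, then symmetrisation
  refine hMinusOneSqW_le_of_symmetric_tests L hg hgsymm hΘc hΘ.symm fun β hβ hβsymm => ?_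
  obtain ⟨s₀, hs₀, hstar⟩ := limit_response_of_approx (F := fun n => mollify (Nat.one_div_pos_of_nat (n := n)) Θ₀) hL hE₀
    (varResponse_of_staticResponse hv hC hK) hVm hVb hg.measurable hBg hΘc hM hnorm hFC hFper hFsymm
    hFM hunif hkin hβ.1 hβ.2 hβsymm
  exact response_endgame hs₀ hstar

/-! ### The box bookkeeping -/

/-- **Box bookkeeping**: the `N`-body bath at density `ρ' = ρN/(N+1)` lives in the box of the
`(N+1)`-body system at density `ρ`: `sideLength ρ' N = sideLength ρ (N+1)` (`N ≥ 1`). [folklore] -/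
theorem sideLength_bath {ρ : ℝ} (hρ : 0 < ρ) (hN : 1 ≤ N) :
    sideLength (ρ * N / (N + 1)) N = sideLength ρ (N + 1) := by
  unfold sideLength
  have hN' : (N : ℝ) ≠ 0 := by exact_mod_cast (by omega : N ≠ 0)
  congr 1
  push_cast
  field_simp

/-- `ρ' = ρN/(N+1) = N/L³` for `L = ((N+1)/ρ)^{1/3}`. [folklore] -/
theorem density_bath {ρ : ℝ} (hρ : 0 < ρ) (N : ℕ) :
    ρ * N / (N + 1) = N / sideLength ρ (N + 1) ^ 3 := by
  -- adapted from `sideLength_pow_three` (BoseGasThermodynamicLimitRuelle): `L³ = (N+1)/ρ`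
  have h3 : sideLength ρ (N + 1) ^ 3 = ((N + 1 : ℕ) : ℝ) / ρ := by
    have h : (0 : ℝ) ≤ ((N + 1 : ℕ) : ℝ) / ρ := div_nonneg (Nat.cast_nonneg _) hρ.le
    rw [sideLength, show (1 / 3 : ℝ) = ((3 : ℕ) : ℝ)⁻¹ by norm_num,
      Real.rpow_inv_natCast_pow h three_ne_zero]
  rw [h3]
  push_cast
  field_simp

end Summit.AtomisticToContinuum.BoseEinsteinCondensation.Theorems.CorrectorClosure.HealingScaleKacInsertion.ResponseDictionary

namespace Summit.AtomisticToContinuum.BoseEinsteinCondensation.Theorems.CorrectorClosure.HealingScaleKacInsertion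

open Literature.MathematicalPhysics.QuantumManyBody.BoseGas
open Summit.AtomisticToContinuum.BoseEinsteinCondensation.Theses.BECInsertionCorrector
open Summit.AtomisticToContinuum.BoseEinsteinCondensation.Theorems.CorrectorClosure.Negative
  (sideLength_succ_pos)
open ResponseDictionary

/-! ### The registered stub -/

/-- **Stub 4 of line `healing-scale-kac-insertion` — the static response bound in `H₋₁` currency (K1
is consumed HERE, by name; bounded potentials).** `StaticResponseBound` gives, for every bounded
repulsive finite-range `v`, thresholds `ρ₁ > 0`, `C > 0` such that for `0 < ρ < ρ₁`, `N ≥ 1`,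
`L = ((N+1)/ρ)^{1/3}` with bounded `v^per`, IF the `N`-body bath in that box has a continuous
positive FK ground state `Θ₀`, then every density mode `g_k = ∑ⱼ cos(p·xⱼ)`, `p = 2πk/L ≠ 0`, has
Kipnis–Varadhan norm `hMinusOneSqW L Θ₀ g_k ≤ C N / max(ρ'a, |p|²)`, `ρ' = N/L³ = ρN/(N+1)`.
(`ρ₁ := ρ₀(K1)`, same `C`; positivity of `Θ₀` and boundedness of `v` itself are not needed.)
[folklore] -/
theorem stub_responseDictionary (hK1 : StaticResponseBound) (v : ℝ → ℝ≥0∞)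
    (hv : IsRepulsiveFiniteRange v) (_hbdd : ∃ C : ℝ≥0, ∀ r, v r ≤ C) :
    ∃ ρ₁ : ℝ, 0 < ρ₁ ∧ ∃ C : ℝ, 0 < C ∧ ∀ ρ : ℝ, 0 < ρ → ρ < ρ₁ → ∀ N : ℕ, 1 ≤ N →
      (∃ C' : ℝ≥0, ∀ x, periodizedPotential v (sideLength ρ (N + 1)) x ≤ C') →
      IsPeriodicGroundStateFK v (sideLength ρ (N + 1))
          (periodicFKGroundState v N (sideLength ρ (N + 1))) →
      Continuous (periodicFKGroundState v N (sideLength ρ (N + 1))) →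
      (∀ X, 0 < periodicFKGroundState v N (sideLength ρ (N + 1)) X) →
      ∀ k : Fin 3 → ℤ, k ≠ 0 →
        hMinusOneSqW (sideLength ρ (N + 1)) (periodicFKGroundState v N (sideLength ρ (N + 1)))
            (fun X : Config N =>
              ∑ j, Real.cos (2 * Real.pi / sideLength ρ (N + 1) * ∑ i, (k i : ℝ) * X j i)) ≤
          ENNReal.ofReal (C * N /
            max (N / sideLength ρ (N + 1) ^ 3 * (scatteringLength v).toReal)
              ((2 * Real.pi / sideLength ρ (N + 1)) ^ 2 * ∑ i, (k i : ℝ) ^ 2)) := by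
  obtain ⟨ρ₀, hρ₀, C, hC, hK⟩ := hK1 v hv
  refine ⟨ρ₀, hρ₀, C, hC, fun ρ hρ hρ₀' N hN hb hΘ hΘc _hΘp k hk => ?_⟩
  obtain ⟨C', hC'⟩ := hb
  have hL : 0 < sideLength ρ (N + 1) := sideLength_succ_pos hρ N
  -- (i) box bookkeeping: K1 for the bath at density `ρ' = ρN/(N+1)` in the same box
  have hρ' : 0 < ρ * N / (N + 1) := by
    have : (0 : ℝ) < N := by exact_mod_cast hN
    positivity
  have hρ'lt : ρ * N / (N + 1) < ρ₀ := by
    have h1 : ρ * N / (N + 1) < ρ := by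
      rw [div_lt_iff₀ (by positivity)]; nlinarith
    exact h1.trans hρ₀'
  have hKL := hK (ρ * N / (N + 1)) hρ' hρ'lt N k hk
  rw [sideLength_bath hρ hN, density_bath hρ N] at hKL
  set CK : ℝ := C * N / max (N / sideLength ρ (N + 1) ^ 3 * (scatteringLength v).toReal)
    ((2 * Real.pi / sideLength ρ (N + 1)) ^ 2 * ∑ i, (k i : ℝ) ^ 2) with hCK
  have hK' : ∀ (t : ℝ) (Ψ : PeriodicTrialState N (sideLength ρ (N + 1))), periodicEnergy v Ψ ≠ ⊤ →
      (periodicGroundStateEnergy v N (sideLength ρ (N + 1))).toReal - CK * t ^ 2 ≤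
        (periodicEnergy v Ψ).toReal + t * ∫ X in cellN N (sideLength ρ (N + 1)),
          (∑ j, Real.cos (2 * Real.pi / sideLength ρ (N + 1) * ∑ i, (k i : ℝ) * X j i)) *
            ‖Ψ.ψ X‖ ^ 2 := by
    intro t Ψ hΨ
    have h := hKL t Ψ hΨ
    have e : C * t ^ 2 * N / max (N / sideLength ρ (N + 1) ^ 3 * (scatteringLength v).toReal)
        ((2 * Real.pi / sideLength ρ (N + 1)) ^ 2 * ∑ i, (k i : ℝ) ^ 2) = CK * t ^ 2 := by
      rw [hCK]; ring
    rw [e] at h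
    exact h
  -- the density mode `g_k = ∑ⱼ cos(p·xⱼ)`: continuous, `|g_k| ≤ N`, permutation symmetric
  have hgc : Continuous fun X : Config N =>
      ∑ j, Real.cos (2 * Real.pi / sideLength ρ (N + 1) * ∑ i, (k i : ℝ) * X j i) := by
    refine continuous_finsetSum _ fun j _ => Real.continuous_cos.comp (continuous_const.mul
      (continuous_finsetSum _ fun i _ => continuous_const.mul ?_))
    exact (PiLp.continuous_apply 2 _ i).comp (continuous_apply j)
  have hgb : ∀ X : Config N,
      |∑ j, Real.cos (2 * Real.pi / sideLength ρ (N + 1) * ∑ i, (k i : ℝ) * X j i)| ≤ N := by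
    intro X
    calc |∑ j, Real.cos (2 * Real.pi / sideLength ρ (N + 1) * ∑ i, (k i : ℝ) * X j i)|
        ≤ ∑ j : Fin N, |Real.cos (2 * Real.pi / sideLength ρ (N + 1) * ∑ i, (k i : ℝ) * X j i)| :=
          Finset.abs_sum_le_sum_abs _ _
      _ ≤ ∑ _j : Fin N, (1 : ℝ) := Finset.sum_le_sum fun j _ => Real.abs_cos_le_one _
      _ = N := by simp
  have hgsymm : ∀ (σ : Equiv.Perm (Fin N)) (X : Config N),
      (∑ j, Real.cos (2 * Real.pi / sideLength ρ (N + 1) * ∑ i, (k i : ℝ) * (X ∘ σ) j i)) =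
        ∑ j, Real.cos (2 * Real.pi / sideLength ρ (N + 1) * ∑ i, (k i : ℝ) * X j i) := fun σ X =>
    Equiv.sum_comp σ (fun j => Real.cos (2 * Real.pi / sideLength ρ (N + 1) * ∑ i, (k i : ℝ) * X j i))
  -- (ii)–(vi) the core
  exact hMinusOneSqW_le_of_fk_staticResponse hv.1 hL hC' hΘ hΘc hgc hgb hgsymm hK'

end Summit.AtomisticToContinuum.BoseEinsteinCondensation.Theorems.CorrectorClosure.HealingScaleKacInsertion

end
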